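import Summits.Ventures.PercRepro.RankLevelSetThroughMinorSix
import Summits.Ventures.PercRepro.RankLevelSetUpFour

/-! # RankLevelSetPerElemSix — (★★) AT LEVEL `6` AND MONO'S STEP `6` FOR EVERY FINITE MATROID, MODULO (↑)₅ AND THE
PAIR (↑)₅ ON THE MATROIDS OF NULLITY `≤ 5` (night-1 g40; dossier §52.11; on `RankLevelSetThroughMinorSix` and
`RankLevelSetUpFour`)

The reductions of `perElemAt_five_aux` one level up: a loop kills every level; a parallel pair `{u, v}` sends level
`6` at `u` to `D_5 ≤ D_6` of the minor `M ／ u ＼ v` (`biIndepCount_five_le_six`) and at another element to (★★) at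
level `5` of the minor (`perElemAt_five`); a coloop splits into the levels `5` and `6` of its deletion
(`perElemAt_five` and the inductive hypothesis, or the exact middle `#E − 1 = 13`); on a coloop-free matroid at an
element in no parallel pair `perElemAt_six_of_coloopFree_of_up_nullity` applies. Hence
**`perElemAt_six_of_residues`** — (★★) at level `6` for every finite matroid with `≥ 14` elements at every
element — and **`mono_step_six_of_residues`** — `(#E − 6) · D_6 ≤ 7 · D_7` — both under the two hypotheses
`hup` ((↑)₅ at every element of every matroid of nullity `≤ 5` with `≥ 12` elements) and `hpair` (the pair (↑)₅).
With `RankLevelSetUpNullityFive` the first is the coloop residue (P) on the loopless nullity-`5` matroids; the second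
is the pair form of (↑) of `RankLevelSetThroughMinorPair`. Every declaration has a docstring; imports: the cell's own
modules and Mathlib only. Axioms: standard. -/

namespace PercRepro

open Set Matroid

variable {α : Type} (M : Matroid α) [M.Finite]

/-- **(★★) AT LEVEL `6` FOR EVERY FINITE MATROID WITH `≥ 14` ELEMENTS, MODULO (↑)₅ AND THE PAIR (↑)₅ ON NULLITY
`≤ 5`**: the reductions (a loop kills every level, a parallel pair sends level `6` to level `5` of the minor, a coloop
splits into the levels `5` and `6` of its deletion) on top of `perElemAt_six_of_coloopFree_of_up_nullity`. -/
theorem perElemAt_six_aux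
    (hup : ∀ (N : Matroid α) [N.Finite], N✶.eRank ≤ 5 → 12 ≤ N.E.ncard → ∀ b ∈ N.E, BiIndepUpAt N b 5)
    (hpair : ∀ (N : Matroid α) [N.Finite], N✶.eRank ≤ 5 → 12 ≤ N.E.ncard →
      ∀ b ∈ N.E, ∀ c ∈ N.E, b ≠ c → BiIndepUpPairAt N b c 5) :
    ∀ n : ℕ, ∀ (M' : Matroid α) [M'.Finite], M'.E.ncard = n →
      ∀ y ∈ M'.E, 14 ≤ n → {Z ∈ biIndep M' 6 | y ∉ Z}.ncard ≤ {Q ∈ biIndep M' 7 | y ∈ Q}.ncard := by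
  intro n
  induction n using Nat.strong_induction_on with
  | _ n ih =>
    intro M' _ hn y hy h14
    by_cases hloop : ∃ ℓ, M'.IsLoop ℓ
    · obtain ⟨ℓ, hℓ⟩ := hloop
      have : {Z ∈ biIndep M' 6 | y ∉ Z} = ∅ := by
        rw [biIndep_eq_empty_of_isLoop M' hℓ 6]
        ext Z; simp
      rw [this, Set.ncard_empty]
      exact Nat.zero_le _
    simp only [not_exists] at hloop
    by_cases hpar : ∃ u v, ParallelPair M' u v
    · obtain ⟨u, v, huv⟩ := hpar
      haveI := contract_delete_finite M' u v
      have hcard := ncard_ground_contract_delete M' huv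
      have hD : ∀ {u v : α} (h : ParallelPair M' u v),
          biIndepCount ((M'.contract {u}).delete {v}) 5 ≤ biIndepCount ((M'.contract {u}).delete {v}) 6 := by
        intro u v h
        haveI := contract_delete_finite M' u v
        have hc := ncard_ground_contract_delete M' h
        exact biIndepCount_five_le_six ((M'.contract {u}).delete {v}) (by rw [hc]; omega)
      by_cases hyu : y = u
      · subst hyu
        exact perElem_succ_of_parallel_self M' huv 5 (hD huv)
      by_cases hyv : y = v
      · subst hyv
        exact perElem_succ_of_parallel_self M' huv.symm 5 (hD huv.symm)
      · have hyN : y ∈ ((M'.contract {u}).delete {v}).E := by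
          rw [ground_contract_delete]
          exact ⟨hy, by simp only [Set.mem_insert_iff, Set.mem_singleton_iff, not_or]; exact ⟨hyu, hyv⟩⟩
        exact perElem_succ_of_parallel_other M' huv hyu hyv 5
          (perElemAt_five ((M'.contract {u}).delete {v}) hyN (by rw [hcard]; omega))
    simp only [not_exists] at hpar
    by_cases hcol : ∃ x, M'.IsColoop x
    · obtain ⟨x, hx⟩ := hcol
      haveI := delete_finite' M' x
      have hcard : (M'.delete {x}).E.ncard = n - 1 := by
        rw [Matroid.delete_ground, Set.ncard_sdiff_singleton_of_mem hx.mem_ground, hn]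
      by_cases hyx : y = x
      · subst hyx
        exact (perElem_coloop_self M' hx 6).le
      · have hyM : y ∈ (M'.delete {x}).E := by
          rw [Matroid.delete_ground]
          exact ⟨hy, by simpa using hyx⟩
        refine perElem_succ_of_coloop M' hx hyx 5 (perElemAt_five (M'.delete {x}) hyM (by omega)) ?_
        rcases Nat.lt_or_ge (n - 1) 14 with h13 | h14'
        · exact (perElem_middle_eq (M'.delete {x}) hyM 6 (by omega)).le
        · exact ih (n - 1) (by omega) (M'.delete {x}) hcard y hyM h14'
    simp only [not_exists] at hcol
    exact perElemAt_six_of_coloopFree_of_up_nullity M' hcol hy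
      (fun _ hz => notMem_closure_singleton_of_no_partner M' hy (hloop y) (hpar y) hz) (by omega) hup hpair

/-- **(★★) AT LEVEL `6` FOR EVERY FINITE MATROID WITH `≥ 14` ELEMENTS AND EVERY ELEMENT, MODULO (↑)₅ AND THE PAIR
(↑)₅ ON NULLITY `≤ 5`**: `#{Z ∈ D_6 : y ∉ Z} ≤ #{Q ∈ D_7 : y ∈ Q}`. -/
theorem perElemAt_six_of_residues
    (hup : ∀ (N : Matroid α) [N.Finite], N✶.eRank ≤ 5 → 12 ≤ N.E.ncard → ∀ b ∈ N.E, BiIndepUpAt N b 5)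
    (hpair : ∀ (N : Matroid α) [N.Finite], N✶.eRank ≤ 5 → 12 ≤ N.E.ncard →
      ∀ b ∈ N.E, ∀ c ∈ N.E, b ≠ c → BiIndepUpPairAt N b c 5)
    {y : α} (hy : y ∈ M.E) (hn : 14 ≤ M.E.ncard) :
    {Z ∈ biIndep M 6 | y ∉ Z}.ncard ≤ {Q ∈ biIndep M 7 | y ∈ Q}.ncard :=
  perElemAt_six_aux hup hpair M.E.ncard M rfl y hy hn

/-- **MONO'S STEP `j = 6` FOR EVERY FINITE MATROID, MODULO THE SAME TWO RESIDUES**: `(#E − 6) · D_6 ≤ 7 · D_7` for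
`14 ≤ #E`. -/
theorem mono_step_six_of_residues
    (hup : ∀ (N : Matroid α) [N.Finite], N✶.eRank ≤ 5 → 12 ≤ N.E.ncard → ∀ b ∈ N.E, BiIndepUpAt N b 5)
    (hpair : ∀ (N : Matroid α) [N.Finite], N✶.eRank ≤ 5 → 12 ≤ N.E.ncard →
      ∀ b ∈ N.E, ∀ c ∈ N.E, b ≠ c → BiIndepUpPairAt N b c 5)
    (hn : 14 ≤ M.E.ncard) : (M.E.ncard - 6) * biIndepCount M 6 ≤ 7 * biIndepCount M 7 :=
  mono_step_of_perElemAt M 6 (fun _ hy => perElemAt_six_of_residues M hup hpair hy hn)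

end PercRepro
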